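import Literature.NumberTheory.Rogawski1990.ArchTestFunctionTwoSidedBounds      -- ★ p848006∕p848164(∕p848390): `continuous_archHSWeightGL`, `archHSWeightGL_pos` (HS weight on `GL_N(L ⊗ ℝ)`)
import Literature.NumberTheory.Automorphic.ArchSchwartzSpace                     -- ★ p848256: `archHSGL`, `archTwoSidedDerivGL`, `ArchSchwartzGL`, `archHSGL_endoEmbArch`
import Literature.NumberTheory.Automorphic.LocalOrbitalIntegral                  -- ★ `orbitalIntegral`, `OrbitalMeasureFamily`, `classOrbitalIntegral`; brings ★ `descConj`
import Literature.NumberTheory.Automorphic.CuspFormArchConvolution               -- ★ `continuous_of_isArchSmooth_gl`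
import Mathlib.Analysis.PSeries
import HarnessLib

/-!
# Orbital integrands of archimedean Schwartz functions are integrable, GIVEN polynomial volume growth of the orbit in the Hilbert–Schmidt weight
# (Harish-Chandra's convergence of Schwartz orbital integrals, reduced to its geometric input; Beuzart-Plessis 2020 §1.5)

Topic `NumberTheory/Rogawski1990`; namespace `Literature.NumberTheory.Rogawski1990`.  THEOREMS ONLY (no `def`, no instance, no notation, no axiom, no named
fact, no `sorry`).  Cell `pub/hodgecm-mathlib`, crux H413 (`stmt-HodgeConjecture-24833`), F0∕P3c line LH3 (closer stub `stub_N9`), DEAL #5 (CONV) of LH3-plan (g0)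
(2026-09-02T02:49:48Z ∕ 02:50:28Z; seat LH3-p04 (g0)): «Schwartz orbital integrals converge on the `G`-regular classes of `H_∞`», stated over LITERATURE names
(★ `ArchSchwartzGL` of `ArchSchwartzSpace`, any letter set `𝔩`, any positive `Ξ`-exponent `e`).

WHAT IS PROVED.
* §1 `integrable_of_norm_mul_weight_le_of_dyadic_volume` — ABSTRACT (any measure space): if `‖F x‖ · w(P x) ≤ C` for a measurable «radius» `P ≥ 1` and a weight `w`
  positive and monotone on `[1, ∞)`, and the dyadic volumes satisfy `∑ₙ μ{P < 2^{n+1}} · w(2ⁿ)⁻¹ < ∞`, then `F` is `μ`-integrable (dyadic shells, `lintegral_tsum`).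
* §2 `dyadic_ratio_le`, `tsum_dyadic_volume_ne_top_of_polynomialGrowth` — the arithmetic: polynomial volume growth `μ{P ≤ R} ≤ A R^e (1 + log R)^m` (`R ≥ 1`) and the Schwartz weight
  `w(r) = r^e (1 + log r)^{m+2}` make the dyadic series converge (comparison with `∑ 1∕(n+1)²`).
* §3 `integrable_descConj_of_archSchwartzGL_of_volumeGrowth` — (CONV) MODULO ITS GEOMETRIC INPUT: for `g ∈ 𝒞` in the sense of ★ `ArchSchwartzGL L 3 𝔩 e ι_∞ g`
  (`ι_∞ : H_∞ ↪ GL₃(L ⊗ ℝ)` = ★ `endoEmbArch`, `e > 0`), any `γ ∈ H_∞ = U(Φ₂)(L⁺ ⊗ ℝ) × U(Φ₁)(L⁺ ⊗ ℝ)` and any measure `μ` on `H_∞ ⧸ Z(γ)` whose volumes of the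
  Hilbert–Schmidt balls along the orbit grow polynomially — `μ{y Z(γ) : archHSGL(ι_∞(y γ y⁻¹)) ≤ R} ≤ A R^e (1 + log R)^m` for `R ≥ 1` (hypothesis `hvol`) — the orbital
  integrand ★ `descConj γ Z(γ) _ g : y Z(γ) ↦ g(y γ y⁻¹)` is Bochner-integrable for `μ`; `integrable_orbitalIntegrand_of_archSchwartzGL_of_volumeGrowth` — the same
  for the member `mH c` of an orbital-measure family at the representative `out c` (the integrand of ★ `classOrbitalIntegral mH g c`, hence of every summand of
  ★ `stableOrbitalIntegralRel`).
THE INPUT NOT PROVED HERE (honest label): the volume-growth hypothesis `hvol` itself — for the Weil-form quotient `dν_H ∕ dt_H` at a `G`-regular `γ` it is Harish-Chandra's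
estimate [BeuzartPlessis2020Asterisque, §1.5 (1.5.2)–(1.5.3) p. 31] (on `U(1,1)`: `vol(K A_{≤S} K) ≍ e^{2S}`), which needs Haar measure of `U(Φ₂)(L⁺ ⊗ ℝ) ≅ ∏_w U(1,1)`
in Cartan∕Iwasawa coordinates — not in the tree at the time of writing; it is the one named residual of DEAL #5.
HONEST LABEL: HC_CM is proved only modulo the 7 printed citations (2 remaining: hLiu418 = stmt-HodgeConjecture-24832, h413 = stmt-HodgeConjecture-24833) until rung 0
closes; this file closes no organ of the `stub_N9` leaf (O1∕O3 are LETTERS) — it hardens the A3 reading «the Schwartz orbital integrals in O1∕O3 are honest integrals».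

## References
* [BeuzartPlessis2020Asterisque] R. Beuzart-Plessis, *A local trace formula for the Gan–Gross–Prasad conjecture for unitary groups: the archimedean case*,
  Astérisque 418 (2020), §1.5 p. 31 (Harish-Chandra Schwartz space; estimates (1.5.2)–(1.5.3); convergence of orbital integrals of `Ξ(1+σ)^{-d}`).
* [Rogawski1990] J. D. Rogawski, *Automorphic Representations of Unitary Groups in Three Variables*, Ann. of Math. Stud. 123 (1990), §4.9 Prop. 4.9.1 (a) p. 55
  («`f^H` in the Schwartz space»), §14.3 p. 234.
* [HarishChandra1966] Harish-Chandra, *Discrete series for semisimple Lie groups II*, Acta Math. 116 (1966), §9 (Schwartz space, convergence of orbital integrals).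
-/

set_option autoImplicit false

noncomputable section

open MeasureTheory NumberField NumberField.mixedEmbedding Topology
open Literature.NumberTheory.Automorphic Literature.MeasureTheory.Group
open scoped MatrixGroups Matrix Classical ENNReal

namespace Literature.NumberTheory.Rogawski1990

/-! ## §1 Abstract: decay against a radius + summable dyadic volumes ⇒ integrable -/

section Abstract

variable {X : Type*} [MeasurableSpace X] {μ : Measure X} {E : Type*} [NormedAddCommGroup E]

/-- **Decay × dyadic volume growth ⇒ integrability.**  On any measure space: if `‖F x‖ · w(P x) ≤ C` for a measurable radius `P ≥ 1` and a weight `w` that is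
positive and monotone on `[1, ∞)`, and `∑ₙ μ{P < 2^{n+1}} · w(2ⁿ)⁻¹ < ∞`, then `F` is integrable: on the shell `2ⁿ ≤ P < 2^{n+1}` one has `‖F‖ ≤ C ∕ w(2ⁿ)`, and the
shells are summed with `lintegral_tsum`. [cite: BeuzartPlessis2020Asterisque, §1.5 p. 31] [cite: HarishChandra1966, §9] -/
theorem integrable_of_norm_mul_weight_le_of_dyadic_volume
    {F : X → E} (hF : AEStronglyMeasurable F μ)
    {P : X → ℝ} (hP : Measurable P) (hP1 : ∀ x, 1 ≤ P x)
    {w : ℝ → ℝ} (hw1 : ∀ r : ℝ, 1 ≤ r → 0 < w r) (hwm : ∀ r s : ℝ, 1 ≤ r → r ≤ s → w r ≤ w s)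
    {C : ℝ} (hC : ∀ x, ‖F x‖ * w (P x) ≤ C)
    (hvol : ∑' n : ℕ, μ {x | P x < 2 ^ (n + 1)} * ENNReal.ofReal ((w (2 ^ n))⁻¹) ≠ ⊤) :
    Integrable F μ := by
  set C' : ℝ := max C 0 with hC'def
  have hC'0 : 0 ≤ C' := le_max_right _ _
  have hCx : ∀ x, ‖F x‖ * w (P x) ≤ C' := fun x => (hC x).trans (le_max_left _ _)
  -- the dyadic shells
  set S : ℕ → Set X := fun n => {x | (2 : ℝ) ^ n ≤ P x ∧ P x < 2 ^ (n + 1)} with hSdef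
  have hSm : ∀ n, MeasurableSet (S n) := fun n =>
    (measurableSet_le measurable_const hP).inter (measurableSet_lt hP measurable_const)
  -- the majorant
  set G : X → ℝ≥0∞ := fun x => ∑' n : ℕ, (S n).indicator (fun _ => ENNReal.ofReal (C' * (w (2 ^ n))⁻¹)) x with hGdef
  have hFG : ∀ x, ‖F x‖ₑ ≤ G x := by
    intro x
    obtain ⟨n, hn, hn'⟩ := exists_nat_pow_near (hP1 x) one_lt_two
    have hxS : x ∈ S n := ⟨hn, hn'⟩
    have h2n : (1 : ℝ) ≤ 2 ^ n := one_le_pow₀ one_le_two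
    have hw2n : 0 < w (2 ^ n) := hw1 _ h2n
    have hwle : w (2 ^ n) ≤ w (P x) := hwm _ _ h2n hn
    have h1 : ‖F x‖ ≤ C' * (w (2 ^ n))⁻¹ := by
      rw [← div_eq_mul_inv, le_div_iff₀ hw2n]
      calc ‖F x‖ * w (2 ^ n) ≤ ‖F x‖ * w (P x) := mul_le_mul_of_nonneg_left hwle (norm_nonneg _)
        _ ≤ C' := hCx x
    calc ‖F x‖ₑ = ENNReal.ofReal ‖F x‖ := (ofReal_norm (F x)).symm
      _ ≤ ENNReal.ofReal (C' * (w (2 ^ n))⁻¹) := ENNReal.ofReal_le_ofReal h1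
      _ = (S n).indicator (fun _ => ENNReal.ofReal (C' * (w (2 ^ n))⁻¹)) x := by rw [Set.indicator_of_mem hxS]
      _ ≤ G x := ENNReal.le_tsum n
  have hGint : ∫⁻ x, G x ∂μ ≠ ⊤ := by
    have hmeas : ∀ n : ℕ, AEMeasurable ((S n).indicator (fun _ => ENNReal.ofReal (C' * (w (2 ^ n))⁻¹))) μ :=
      fun n => (measurable_const.indicator (hSm n)).aemeasurable
    have hG' : ∫⁻ x, G x ∂μ = ∑' n : ℕ, ENNReal.ofReal (C' * (w (2 ^ n))⁻¹) * μ (S n) := by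
      rw [hGdef, lintegral_tsum hmeas]
      exact tsum_congr fun n => lintegral_indicator_const (hSm n) _
    have hle : ∀ n : ℕ, ENNReal.ofReal (C' * (w (2 ^ n))⁻¹) * μ (S n) ≤
        ENNReal.ofReal C' * (μ {x | P x < 2 ^ (n + 1)} * ENNReal.ofReal ((w (2 ^ n))⁻¹)) := by
      intro n
      have hsub : S n ⊆ {x | P x < 2 ^ (n + 1)} := fun x hx => hx.2
      calc ENNReal.ofReal (C' * (w (2 ^ n))⁻¹) * μ (S n)
          = ENNReal.ofReal C' * ENNReal.ofReal ((w (2 ^ n))⁻¹) * μ (S n) := by rw [ENNReal.ofReal_mul hC'0]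
        _ ≤ ENNReal.ofReal C' * ENNReal.ofReal ((w (2 ^ n))⁻¹) * μ {x | P x < 2 ^ (n + 1)} :=
            mul_le_mul' le_rfl (measure_mono hsub)
        _ = ENNReal.ofReal C' * (μ {x | P x < 2 ^ (n + 1)} * ENNReal.ofReal ((w (2 ^ n))⁻¹)) := by ring
    rw [hG']
    refine ne_top_of_le_ne_top ?_ (ENNReal.tsum_le_tsum hle)
    rw [ENNReal.tsum_mul_left]
    exact ENNReal.mul_ne_top ENNReal.ofReal_ne_top hvol
  refine ⟨hF, ?_⟩
  exact lt_of_le_of_lt (lintegral_mono hFG) (lt_top_iff_ne_top.2 hGint)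

end Abstract

/-! ## §2 The arithmetic: polynomial growth `A R^e (1 + log R)^m` against the Schwartz weight `r^e (1 + log r)^{m+2}` -/

section Arithmetic

/-- `log 2 ≤ 1`. [folklore] -/
private theorem log_two_le_one : Real.log 2 ≤ 1 := by
  have h := Real.log_le_sub_one_of_pos (show (0 : ℝ) < 2 by norm_num)
  linarith

/-- The dyadic comparison: for `A ≥ 0`, `e` real, `m : ℕ` and every `n`,
`A (2^{n+1})^e (1 + log 2^{n+1})^m · ((2ⁿ)^e (1 + log 2ⁿ)^{m+2})⁻¹ ≤ (A 2^e 2^m ∕ (log 2)²) ∕ (n+1)²`. [folklore] -/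
private theorem dyadic_ratio_le (A e : ℝ) (hA : 0 ≤ A) (m n : ℕ) :
    A * ((2 : ℝ) ^ (n + 1)) ^ e * (1 + Real.log ((2 : ℝ) ^ (n + 1))) ^ m *
        (((2 : ℝ) ^ n) ^ e * (1 + Real.log ((2 : ℝ) ^ n)) ^ (m + 2))⁻¹ ≤
      A * (2 : ℝ) ^ e * 2 ^ m / (Real.log 2) ^ 2 / ((n : ℝ) + 1) ^ 2 := by
  have hl2 : 0 < Real.log 2 := Real.log_pos one_lt_two
  have hl21 : Real.log 2 ≤ 1 := log_two_le_one
  have hX : 0 < ((2 : ℝ) ^ n) ^ e := Real.rpow_pos_of_pos (pow_pos two_pos n) e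
  set a : ℝ := 1 + Real.log ((2 : ℝ) ^ n) with ha_def
  set b : ℝ := 1 + Real.log ((2 : ℝ) ^ (n + 1)) with hb_def
  have ha : a = 1 + n * Real.log 2 := by rw [ha_def, Real.log_pow]
  have hb : b = 1 + (n + 1) * Real.log 2 := by rw [hb_def, Real.log_pow]; push_cast; ring
  have ha1 : 1 ≤ a := by rw [ha]; nlinarith [Nat.cast_nonneg (α := ℝ) n]
  have ha0 : 0 < a := lt_of_lt_of_le one_pos ha1
  have hb0 : 0 ≤ b := by rw [hb]; positivity
  have hba : b ≤ 2 * a := by rw [ha, hb]; nlinarith [Nat.cast_nonneg (α := ℝ) n]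
  have hna : ((n : ℝ) + 1) * Real.log 2 ≤ a := by rw [ha]; nlinarith [Nat.cast_nonneg (α := ℝ) n]
  have hn1 : 0 < (n : ℝ) + 1 := by positivity
  -- (2^(n+1))^e = 2^e * (2^n)^e
  have hpow : ((2 : ℝ) ^ (n + 1)) ^ e = (2 : ℝ) ^ e * ((2 : ℝ) ^ n) ^ e := by
    rw [pow_succ', Real.mul_rpow (by norm_num) (pow_nonneg (by norm_num) n)]
  rw [hpow]
  -- reduce to `b^m / a^(m+2) ≤ 2^m / (log 2)^2 / (n+1)^2`
  have hkey : b ^ m * (a ^ (m + 2))⁻¹ ≤ (2 : ℝ) ^ m / (Real.log 2) ^ 2 / ((n : ℝ) + 1) ^ 2 := by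
    have hbm : b ^ m ≤ (2 * a) ^ m := pow_le_pow_left₀ hb0 hba m
    have ham : 0 < a ^ (m + 2) := pow_pos ha0 _
    rw [← div_eq_mul_inv, div_le_iff₀ ham]
    have hsq : (((n : ℝ) + 1) * Real.log 2) ^ 2 ≤ a ^ 2 := pow_le_pow_left₀ (by positivity) hna 2
    calc b ^ m ≤ (2 * a) ^ m := hbm
      _ = 2 ^ m * a ^ m := mul_pow _ _ _
      _ = 2 ^ m / (Real.log 2) ^ 2 / ((n : ℝ) + 1) ^ 2 * ((((n : ℝ) + 1) * Real.log 2) ^ 2 * a ^ m) := by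
          field_simp
      _ ≤ 2 ^ m / (Real.log 2) ^ 2 / ((n : ℝ) + 1) ^ 2 * (a ^ 2 * a ^ m) := by
          apply mul_le_mul_of_nonneg_left (mul_le_mul_of_nonneg_right hsq (pow_nonneg ha0.le m))
          positivity
      _ = 2 ^ m / (Real.log 2) ^ 2 / ((n : ℝ) + 1) ^ 2 * a ^ (m + 2) := by ring
  calc A * ((2 : ℝ) ^ e * ((2 : ℝ) ^ n) ^ e) * b ^ m * ((((2 : ℝ) ^ n) ^ e) * a ^ (m + 2))⁻¹
      = A * (2 : ℝ) ^ e * (b ^ m * (a ^ (m + 2))⁻¹) := by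
        field_simp
    _ ≤ A * (2 : ℝ) ^ e * ((2 : ℝ) ^ m / (Real.log 2) ^ 2 / ((n : ℝ) + 1) ^ 2) :=
        mul_le_mul_of_nonneg_left hkey (mul_nonneg hA (Real.rpow_nonneg (by norm_num) e))
    _ = A * (2 : ℝ) ^ e * 2 ^ m / (Real.log 2) ^ 2 / ((n : ℝ) + 1) ^ 2 := by ring

/-- **Polynomial volume growth makes the dyadic series of §1 converge** for the Schwartz weight `w(r) = r^e (1 + log r)^{m+2}`: if
`μ{P ≤ R} ≤ A R^e (1 + log R)^m` for all `R ≥ 1`, then `∑ₙ μ{P < 2^{n+1}} · w(2ⁿ)⁻¹ < ∞`. [cite: BeuzartPlessis2020Asterisque, §1.5 (1.5.2)–(1.5.3) p. 31] -/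
theorem tsum_dyadic_volume_ne_top_of_polynomialGrowth
    {X : Type*} [MeasurableSpace X] (μ : Measure X) (P : X → ℝ) (e A : ℝ) (m : ℕ)
    (hvol : ∀ R : ℝ, 1 ≤ R → μ {x | P x ≤ R} ≤ ENNReal.ofReal (A * R ^ e * (1 + Real.log R) ^ m)) :
    ∑' n : ℕ, μ {x | P x < 2 ^ (n + 1)} *
        ENNReal.ofReal ((((2 : ℝ) ^ n) ^ e * (1 + Real.log ((2 : ℝ) ^ n)) ^ (m + 2))⁻¹) ≠ ⊤ := by
  set A' : ℝ := max A 0 with hA'def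
  have hA'0 : 0 ≤ A' := le_max_right _ _
  set K : ℝ := A' * (2 : ℝ) ^ e * 2 ^ m / (Real.log 2) ^ 2 with hKdef
  have hK0 : 0 ≤ K := by rw [hKdef]; positivity
  -- termwise bound
  have hterm : ∀ n : ℕ, μ {x | P x < 2 ^ (n + 1)} *
      ENNReal.ofReal ((((2 : ℝ) ^ n) ^ e * (1 + Real.log ((2 : ℝ) ^ n)) ^ (m + 2))⁻¹) ≤
        ENNReal.ofReal (K / ((n : ℝ) + 1) ^ 2) := by
    intro n
    have hR : (1 : ℝ) ≤ 2 ^ (n + 1) := one_le_pow₀ one_le_two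
    have hRpos : (0 : ℝ) < 2 ^ (n + 1) := pow_pos two_pos _
    have hlogR : 0 ≤ Real.log ((2 : ℝ) ^ (n + 1)) := Real.log_nonneg hR
    have hμ : μ {x | P x < 2 ^ (n + 1)} ≤ ENNReal.ofReal (A' * ((2 : ℝ) ^ (n + 1)) ^ e * (1 + Real.log ((2 : ℝ) ^ (n + 1))) ^ m) := by
      refine (measure_mono fun x (hx : P x < 2 ^ (n + 1)) => ?_).trans ((hvol _ hR).trans (ENNReal.ofReal_le_ofReal ?_))
      · exact le_of_lt hx
      · have hpos : 0 ≤ ((2 : ℝ) ^ (n + 1)) ^ e * (1 + Real.log ((2 : ℝ) ^ (n + 1))) ^ m :=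
          mul_nonneg (Real.rpow_nonneg hRpos.le e) (pow_nonneg (by linarith) m)
        calc A * ((2 : ℝ) ^ (n + 1)) ^ e * (1 + Real.log ((2 : ℝ) ^ (n + 1))) ^ m
            = A * (((2 : ℝ) ^ (n + 1)) ^ e * (1 + Real.log ((2 : ℝ) ^ (n + 1))) ^ m) := by ring
          _ ≤ A' * (((2 : ℝ) ^ (n + 1)) ^ e * (1 + Real.log ((2 : ℝ) ^ (n + 1))) ^ m) :=
              mul_le_mul_of_nonneg_right (le_max_left _ _) hpos
          _ = A' * ((2 : ℝ) ^ (n + 1)) ^ e * (1 + Real.log ((2 : ℝ) ^ (n + 1))) ^ m := by ring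
    have hwinv : 0 ≤ (((2 : ℝ) ^ n) ^ e * (1 + Real.log ((2 : ℝ) ^ n)) ^ (m + 2))⁻¹ := by
      have : 0 ≤ Real.log ((2 : ℝ) ^ n) := Real.log_nonneg (one_le_pow₀ one_le_two)
      exact inv_nonneg.2 (mul_nonneg (Real.rpow_nonneg (pow_nonneg (by norm_num) n) e) (pow_nonneg (by linarith) _))
    calc μ {x | P x < 2 ^ (n + 1)} * ENNReal.ofReal ((((2 : ℝ) ^ n) ^ e * (1 + Real.log ((2 : ℝ) ^ n)) ^ (m + 2))⁻¹)
        ≤ ENNReal.ofReal (A' * ((2 : ℝ) ^ (n + 1)) ^ e * (1 + Real.log ((2 : ℝ) ^ (n + 1))) ^ m) *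
            ENNReal.ofReal ((((2 : ℝ) ^ n) ^ e * (1 + Real.log ((2 : ℝ) ^ n)) ^ (m + 2))⁻¹) := mul_le_mul' hμ le_rfl
      _ = ENNReal.ofReal (A' * ((2 : ℝ) ^ (n + 1)) ^ e * (1 + Real.log ((2 : ℝ) ^ (n + 1))) ^ m *
            (((2 : ℝ) ^ n) ^ e * (1 + Real.log ((2 : ℝ) ^ n)) ^ (m + 2))⁻¹) := by
          rw [← ENNReal.ofReal_mul']
          exact hwinv
      _ ≤ ENNReal.ofReal (K / ((n : ℝ) + 1) ^ 2) := ENNReal.ofReal_le_ofReal (dyadic_ratio_le A' e hA'0 m n)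
  -- the comparison series
  have hsum : Summable fun n : ℕ => K / ((n : ℝ) + 1) ^ 2 := by
    have h2 : Summable fun n : ℕ => 1 / ((n : ℝ) + 1) ^ 2 := by
      have h := (summable_nat_add_iff 1).mpr (Real.summable_one_div_nat_pow.mpr one_lt_two)
      simpa [Nat.cast_add, Nat.cast_one] using h
    simpa [div_eq_mul_one_div K] using h2.mul_left K
  refine ne_top_of_le_ne_top ?_ (ENNReal.tsum_le_tsum hterm)
  rw [← ENNReal.ofReal_tsum_of_nonneg (fun n => by positivity) hsum]
  exact ENNReal.ofReal_ne_top

end Arithmetic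

/-! ## §3 (CONV) modulo volume growth: orbital integrands of `𝒞(H_∞)` functions -/

section Weight

variable (L : Type) [Field L] [NumberField L] [IsCMField L]

/-- `archHSGL (ι_∞ k) ≥ 1` on `H_∞` (★ `archHSGL_endoEmbArch`: a product of factors `Σ|·|² + 1 ≥ 1`). [cite: BeuzartPlessis2020Asterisque, §1.5 Prop. 1.5.1 (i) p. 29] -/
theorem one_le_archHSGL_endoEmbArch
    (k : (↥(UnitaryGroup.arch (↥(maximalRealSubfield L)) L (IsCMField.complexConj L) 2
          (Matrix.of fun i j : Fin 2 => if i.val + j.val + 1 = 2 then (1 : L) else 0)) ×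
        ↥(UnitaryGroup.arch (↥(maximalRealSubfield L)) L (IsCMField.complexConj L) 1
          (Matrix.of fun i j : Fin 1 => if i.val + j.val + 1 = 1 then (1 : L) else 0)))) :
    1 ≤ archHSGL L 3 ((endoEmbArch L k).val : GL (Fin 3) (mixedSpace L)) := by
  rw [archHSGL_endoEmbArch]
  calc (1 : ℝ) = ∏ _w : {w : InfinitePlace L // w.IsComplex}, (1 : ℝ) := Finset.prod_const_one.symm
    _ ≤ _ := Finset.prod_le_prod (fun _ _ => zero_le_one) fun w _ =>
        le_add_of_nonneg_left (Finset.sum_nonneg fun i _ => Finset.sum_nonneg fun j _ => by positivity)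

end Weight

section Endo

variable {L : Type} [Field L] [NumberField L] [IsCMField L]

/-- **(CONV) modulo volume growth — the orbital integrand of a Schwartz function is integrable along any orbit whose Hilbert–Schmidt balls have polynomial
volume.**  Let `g ∈ 𝒞(H_∞)` in the sense of ★ `ArchSchwartzGL L 3 𝔩 e ι_∞ g` (`e > 0`; only the empty words are used, so any `𝔩`), `γ ∈ H_∞`, and `μ` a measure on
`H_∞ ⧸ Z(γ)` with `μ{y Z(γ) : archHSGL(ι_∞(y γ y⁻¹)) ≤ R} ≤ A R^e (1 + log R)^m` for `R ≥ 1`.  Then `y Z(γ) ↦ g(y γ y⁻¹)` (★ `descConj`) is `μ`-integrable: decay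
`|g| ≤ C_d ∕ (archHSGL^e (1 + log archHSGL)^d)` with `d = m + 2` (the Schwartz bound at `u = v = []`), §1 and §2.  For the Weil-form quotient `dν_H ∕ dt_H` at a
`G`-regular `γ` the volume hypothesis is Harish-Chandra's estimate (not proved here). [cite: BeuzartPlessis2020Asterisque, §1.5 (1.5.2)–(1.5.3) p. 31]
[cite: HarishChandra1966, §9] [cite: Rogawski1990, §4.9 Prop. 4.9.1 (a) p. 55] -/
theorem integrable_descConj_of_archSchwartzGL_of_volumeGrowth
    (𝔩 : Set (Matrix (Fin 3) (Fin 3) (mixedSpace L))) {e : ℝ} (he : 0 < e)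
    {g : (↥(UnitaryGroup.arch (↥(maximalRealSubfield L)) L (IsCMField.complexConj L) 2
          (Matrix.of fun i j : Fin 2 => if i.val + j.val + 1 = 2 then (1 : L) else 0)) ×
        ↥(UnitaryGroup.arch (↥(maximalRealSubfield L)) L (IsCMField.complexConj L) 1
          (Matrix.of fun i j : Fin 1 => if i.val + j.val + 1 = 1 then (1 : L) else 0))) → ℂ}
    (hg : ArchSchwartzGL L 3 𝔩 e (fun k => ((endoEmbArch L k).val : GL (Fin 3) (mixedSpace L))) g)
    (γ : (↥(UnitaryGroup.arch (↥(maximalRealSubfield L)) L (IsCMField.complexConj L) 2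
          (Matrix.of fun i j : Fin 2 => if i.val + j.val + 1 = 2 then (1 : L) else 0)) ×
        ↥(UnitaryGroup.arch (↥(maximalRealSubfield L)) L (IsCMField.complexConj L) 1
          (Matrix.of fun i j : Fin 1 => if i.val + j.val + 1 = 1 then (1 : L) else 0))))
    [MeasurableSpace ((↥(UnitaryGroup.arch (↥(maximalRealSubfield L)) L (IsCMField.complexConj L) 2
          (Matrix.of fun i j : Fin 2 => if i.val + j.val + 1 = 2 then (1 : L) else 0)) ×
        ↥(UnitaryGroup.arch (↥(maximalRealSubfield L)) L (IsCMField.complexConj L) 1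
          (Matrix.of fun i j : Fin 1 => if i.val + j.val + 1 = 1 then (1 : L) else 0))) ⧸ Subgroup.centralizer ({γ} : Set _))]
    [BorelSpace ((↥(UnitaryGroup.arch (↥(maximalRealSubfield L)) L (IsCMField.complexConj L) 2
          (Matrix.of fun i j : Fin 2 => if i.val + j.val + 1 = 2 then (1 : L) else 0)) ×
        ↥(UnitaryGroup.arch (↥(maximalRealSubfield L)) L (IsCMField.complexConj L) 1
          (Matrix.of fun i j : Fin 1 => if i.val + j.val + 1 = 1 then (1 : L) else 0))) ⧸ Subgroup.centralizer ({γ} : Set _))]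
    (μ : Measure ((↥(UnitaryGroup.arch (↥(maximalRealSubfield L)) L (IsCMField.complexConj L) 2
          (Matrix.of fun i j : Fin 2 => if i.val + j.val + 1 = 2 then (1 : L) else 0)) ×
        ↥(UnitaryGroup.arch (↥(maximalRealSubfield L)) L (IsCMField.complexConj L) 1
          (Matrix.of fun i j : Fin 1 => if i.val + j.val + 1 = 1 then (1 : L) else 0))) ⧸ Subgroup.centralizer ({γ} : Set _)))
    (hvol : ∃ (A : ℝ) (m : ℕ), ∀ R : ℝ, 1 ≤ R →
      μ {x | descConj γ (Subgroup.centralizer ({γ} : Set _)) (fun _ h => Subgroup.mem_centralizer_singleton_iff.1 h)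
              (fun y => archHSGL L 3 ((endoEmbArch L y).val : GL (Fin 3) (mixedSpace L))) x ≤ R} ≤
        ENNReal.ofReal (A * R ^ e * (1 + Real.log R) ^ m)) :
    Integrable (descConj γ (Subgroup.centralizer ({γ} : Set _)) (fun _ h => Subgroup.mem_centralizer_singleton_iff.1 h) g) μ := by
  obtain ⟨A, m, hvol⟩ := hvol
  obtain ⟨φ, hφsm, hφf, hbd⟩ := hg
  -- continuity of `g` and of the radius
  have hι : Continuous fun k : (↥(UnitaryGroup.arch (↥(maximalRealSubfield L)) L (IsCMField.complexConj L) 2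
          (Matrix.of fun i j : Fin 2 => if i.val + j.val + 1 = 2 then (1 : L) else 0)) ×
        ↥(UnitaryGroup.arch (↥(maximalRealSubfield L)) L (IsCMField.complexConj L) 1
          (Matrix.of fun i j : Fin 1 => if i.val + j.val + 1 = 1 then (1 : L) else 0))) =>
      ((endoEmbArch L k).val : GL (Fin 3) (mixedSpace L)) :=
    continuous_subtype_val.comp (continuous_endoEmbArch L)
  have hgc : Continuous g := by
    have e1 : g = fun k => φ ((endoEmbArch L k).val : GL (Fin 3) (mixedSpace L)) := funext hφf
    rw [e1]
    exact (continuous_of_isArchSmooth_gl hφsm).comp hι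
  have hPc : Continuous fun k : (↥(UnitaryGroup.arch (↥(maximalRealSubfield L)) L (IsCMField.complexConj L) 2
          (Matrix.of fun i j : Fin 2 => if i.val + j.val + 1 = 2 then (1 : L) else 0)) ×
        ↥(UnitaryGroup.arch (↥(maximalRealSubfield L)) L (IsCMField.complexConj L) 1
          (Matrix.of fun i j : Fin 1 => if i.val + j.val + 1 = 1 then (1 : L) else 0))) =>
      archHSGL L 3 ((endoEmbArch L k).val : GL (Fin 3) (mixedSpace L)) := by
    have h3 : Continuous (archHSGL L 3) := by
      unfold archHSGL
      exact continuous_archHSWeightGL L 3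
    exact h3.comp hι
  -- the Schwartz bound at the empty words, exponent `d = m + 2`
  obtain ⟨C, hC⟩ := hbd [] [] (fun _ h => nomatch h) (fun _ h => nomatch h) (m + 2)
  have hC' : ∀ k, ‖g k‖ * (archHSGL L 3 ((endoEmbArch L k).val : GL (Fin 3) (mixedSpace L)) ^ e *
      (1 + Real.log (archHSGL L 3 ((endoEmbArch L k).val : GL (Fin 3) (mixedSpace L)))) ^ (m + 2)) ≤ C := by
    intro k
    have h := hC k
    simp only [archTwoSidedDerivGL, iterLieDeriv_nil, inv_inv] at h
    rw [← hφf k, mul_assoc] at h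
    exact h
  refine integrable_of_norm_mul_weight_le_of_dyadic_volume
    (hgc |> continuous_descConj γ _ _ |>.aestronglyMeasurable)
    ((continuous_descConj γ _ _ hPc).measurable)
    (fun x => ?_) (w := fun r => r ^ e * (1 + Real.log r) ^ (m + 2)) (fun r hr => ?_) (fun r s hr hrs => ?_) (C := C) (fun x => ?_)
    (tsum_dyadic_volume_ne_top_of_polynomialGrowth μ _ e A m hvol)
  · -- `P ≥ 1`
    induction x using QuotientGroup.induction_on with
    | H y => exact one_le_archHSGL_endoEmbArch L _
  · -- `w > 0` on `[1, ∞)`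
    have h1 : 0 < r := lt_of_lt_of_le one_pos hr
    have h2 : 0 ≤ Real.log r := Real.log_nonneg hr
    exact mul_pos (Real.rpow_pos_of_pos h1 e) (pow_pos (by linarith) _)
  · -- `w` monotone on `[1, ∞)`
    have h1 : 0 < r := lt_of_lt_of_le one_pos hr
    have h2 : 0 ≤ Real.log r := Real.log_nonneg hr
    have h3 : Real.log r ≤ Real.log s := Real.log_le_log h1 hrs
    exact mul_le_mul (Real.rpow_le_rpow h1.le hrs he.le) (pow_le_pow_left₀ (by linarith) (by linarith) _)
      (pow_nonneg (by linarith) _) (Real.rpow_nonneg (h1.le.trans hrs) e)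
  · -- the decay bound on the quotient
    induction x using QuotientGroup.induction_on with
    | H y => exact hC' _

/-- **(CONV) for a member of an orbital-measure family**: under the same volume-growth hypothesis at the class `c`, the integrand of ★ `classOrbitalIntegral mH g c`
(= ★ `orbitalIntegral (out c) g (mH c)`) is integrable — so every summand of ★ `stableOrbitalIntegralRel … mH g γ_H` over such classes is an honest Bochner integral.
[cite: BeuzartPlessis2020Asterisque, §1.5 p. 31] [cite: Rogawski1990, §4.9 p. 54; Prop. 4.9.1 (a) p. 55] -/
theorem integrable_orbitalIntegrand_of_archSchwartzGL_of_volumeGrowth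
    (𝔩 : Set (Matrix (Fin 3) (Fin 3) (mixedSpace L))) {e : ℝ} (he : 0 < e)
    {g : (↥(UnitaryGroup.arch (↥(maximalRealSubfield L)) L (IsCMField.complexConj L) 2
          (Matrix.of fun i j : Fin 2 => if i.val + j.val + 1 = 2 then (1 : L) else 0)) ×
        ↥(UnitaryGroup.arch (↥(maximalRealSubfield L)) L (IsCMField.complexConj L) 1
          (Matrix.of fun i j : Fin 1 => if i.val + j.val + 1 = 1 then (1 : L) else 0))) → ℂ}
    (hg : ArchSchwartzGL L 3 𝔩 e (fun k => ((endoEmbArch L k).val : GL (Fin 3) (mixedSpace L))) g)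
    [∀ a : (↥(UnitaryGroup.arch (↥(maximalRealSubfield L)) L (IsCMField.complexConj L) 2
          (Matrix.of fun i j : Fin 2 => if i.val + j.val + 1 = 2 then (1 : L) else 0)) ×
        ↥(UnitaryGroup.arch (↥(maximalRealSubfield L)) L (IsCMField.complexConj L) 1
          (Matrix.of fun i j : Fin 1 => if i.val + j.val + 1 = 1 then (1 : L) else 0))),
      MeasurableSpace ((↥(UnitaryGroup.arch (↥(maximalRealSubfield L)) L (IsCMField.complexConj L) 2
          (Matrix.of fun i j : Fin 2 => if i.val + j.val + 1 = 2 then (1 : L) else 0)) ×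
        ↥(UnitaryGroup.arch (↥(maximalRealSubfield L)) L (IsCMField.complexConj L) 1
          (Matrix.of fun i j : Fin 1 => if i.val + j.val + 1 = 1 then (1 : L) else 0))) ⧸ Subgroup.centralizer ({a} : Set _))]
    [∀ a : (↥(UnitaryGroup.arch (↥(maximalRealSubfield L)) L (IsCMField.complexConj L) 2
          (Matrix.of fun i j : Fin 2 => if i.val + j.val + 1 = 2 then (1 : L) else 0)) ×
        ↥(UnitaryGroup.arch (↥(maximalRealSubfield L)) L (IsCMField.complexConj L) 1
          (Matrix.of fun i j : Fin 1 => if i.val + j.val + 1 = 1 then (1 : L) else 0))),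
      BorelSpace ((↥(UnitaryGroup.arch (↥(maximalRealSubfield L)) L (IsCMField.complexConj L) 2
          (Matrix.of fun i j : Fin 2 => if i.val + j.val + 1 = 2 then (1 : L) else 0)) ×
        ↥(UnitaryGroup.arch (↥(maximalRealSubfield L)) L (IsCMField.complexConj L) 1
          (Matrix.of fun i j : Fin 1 => if i.val + j.val + 1 = 1 then (1 : L) else 0))) ⧸ Subgroup.centralizer ({a} : Set _))]
    (mH : OrbitalMeasureFamily ((↥(UnitaryGroup.arch (↥(maximalRealSubfield L)) L (IsCMField.complexConj L) 2
          (Matrix.of fun i j : Fin 2 => if i.val + j.val + 1 = 2 then (1 : L) else 0)) ×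
        ↥(UnitaryGroup.arch (↥(maximalRealSubfield L)) L (IsCMField.complexConj L) 1
          (Matrix.of fun i j : Fin 1 => if i.val + j.val + 1 = 1 then (1 : L) else 0)))))
    (c : ConjClasses ((↥(UnitaryGroup.arch (↥(maximalRealSubfield L)) L (IsCMField.complexConj L) 2
          (Matrix.of fun i j : Fin 2 => if i.val + j.val + 1 = 2 then (1 : L) else 0)) ×
        ↥(UnitaryGroup.arch (↥(maximalRealSubfield L)) L (IsCMField.complexConj L) 1
          (Matrix.of fun i j : Fin 1 => if i.val + j.val + 1 = 1 then (1 : L) else 0)))))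
    (hvol : ∃ (A : ℝ) (m : ℕ), ∀ R : ℝ, 1 ≤ R →
      (mH c) {x | descConj (Quotient.out c) (Subgroup.centralizer ({Quotient.out c} : Set _))
              (fun _ h => Subgroup.mem_centralizer_singleton_iff.1 h)
              (fun y => archHSGL L 3 ((endoEmbArch L y).val : GL (Fin 3) (mixedSpace L))) x ≤ R} ≤
        ENNReal.ofReal (A * R ^ e * (1 + Real.log R) ^ m)) :
    Integrable (descConj (Quotient.out c) (Subgroup.centralizer ({Quotient.out c} : Set _))
      (fun _ h => Subgroup.mem_centralizer_singleton_iff.1 h) g) (mH c) :=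
  integrable_descConj_of_archSchwartzGL_of_volumeGrowth 𝔩 he hg (Quotient.out c) (mH c) hvol

end Endo

end Literature.NumberTheory.Rogawski1990

end
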